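import Literature.Probability.Percolation.FiniteClustersPercolationOneArm
import HarnessLib

/-!
# Route `PercMonotoneFactors`, item `LocalUniquenessCriterion` (stmt-CriticalPhenomena-4492) — label-side tools

Helper file (lands with `--supports stmt-CriticalPhenomena-4492`).  Measure-theoretic and locality
tools for the same-`t` static renormalisation of a monotone finite-range factor `F` of Bernoulli
bond percolation on `ℤ³` (Liggett–Schonmann–Stacey 1997 §1: block factors of product measures are
finitely dependent and translation invariant): restriction of the labels to lattice edges is
measurable and does not change the law of `F`; the block-factor law `P_t ∘ F⁻¹` is translation
invariant when `F` commutes with the automorphisms of `ℤ³`; a union bound; finiteness of the sets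
of pairs near a point; and LOCALITY — an output event determined by the pairs within `r` of `c`
pulls back, through `ω ↦ F (ω ∩ E(ℤ³))`, to a label event determined by the lattice edges with an
end within `r + R` of `c` (`R` the range of `F`).  No definitions.
-/

noncomputable section

namespace Summit.CriticalPhenomena.PercolationContinuityZ3.Theorems

open MeasureTheory Set Literature.Probability.Percolation Literature.Probability.LatticeModels

namespace PercMonotoneFactorsLocalUniquenessCriterion

/-! ### Label-side tools -/

/-- Restriction of a configuration to the lattice edges is measurable. [folklore] -/
theorem measurable_inter_edgeSet :
    Measurable fun ω : BondConfig (Site 3) => ω ∩ (zdGraph 3).edgeSet :=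
  measurable_set_iff.2 fun e => (measurable_set_mem e).and measurable_const

/-- `P_t`-a.s. `ω ⊆ E(ℤ³)`, so pre-restricting `F` to lattice edges does not change its law.
[folklore] -/
theorem map_restrict_eq (F : BondConfig (Site 3) → BondConfig (Site 3)) (t : unitInterval) :
    (bondPercolation (zdGraph 3) t).map (fun ω => F (ω ∩ (zdGraph 3).edgeSet)) =
      (bondPercolation (zdGraph 3) t).map F := by
  refine Measure.map_congr ?_
  filter_upwards [ae_subset_edgeSet (zdGraph 3) t] with ω hω
  rw [Set.inter_eq_self_of_subset_left hω]

/-- **Translation invariance of a block-factor law**: for measurable `F` commuting with the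
automorphisms of `ℤ³`, the push-forward `P_t ∘ F⁻¹` is invariant under every shift of
configurations (`bondPercolation_map_shift` and `Measure.map_map`).
[cite: LiggettSchonmannStacey1997, §1 (block factors)] -/
theorem map_relabel_shift_eq {F : BondConfig (Site 3) → BondConfig (Site 3)} (hFm : Measurable F)
    (hFeq : ∀ (φ : zdGraph 3 ≃g zdGraph 3) (ω : BondConfig (Site 3)),
      F (Sym2.map φ '' ω) = Sym2.map φ '' (F ω))
    (t : unitInterval) (v : Site 3) :
    ((bondPercolation (zdGraph 3) t).map F).map (BondConfig.relabel (sym2Equiv (Site.shift v))) =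
      (bondPercolation (zdGraph 3) t).map F := by
  let φ : zdGraph 3 ≃g zdGraph 3 :=
    { toEquiv := Site.shift v, map_rel_iff' := fun {a b} => zdGraph_adj_shift_iff v a b }
  have hcomm : (BondConfig.relabel (sym2Equiv (Site.shift v)) : BondConfig (Site 3) → BondConfig (Site 3)) ∘ F =
      F ∘ (BondConfig.relabel (sym2Equiv (Site.shift v))) := by
    funext ω
    exact (hFeq φ ω).symm
  rw [Measure.map_map (BondConfig.relabel _).measurable hFm, hcomm,
    ← Measure.map_map hFm (BondConfig.relabel _).measurable, bondPercolation_map_shift]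

/-- Applied form of `map_relabel_shift_eq`: `μ {ξ | ξ + v ∈ S} = μ S` for the block-factor law
`μ`. [cite: LiggettSchonmannStacey1997, §1 (block factors)] -/
theorem real_preimage_relabel_shift {F : BondConfig (Site 3) → BondConfig (Site 3)}
    (hFm : Measurable F)
    (hFeq : ∀ (φ : zdGraph 3 ≃g zdGraph 3) (ω : BondConfig (Site 3)),
      F (Sym2.map φ '' ω) = Sym2.map φ '' (F ω))
    (t : unitInterval) (v : Site 3) (S : Set (BondConfig (Site 3))) :
    ((bondPercolation (zdGraph 3) t).map F).real
        (BondConfig.relabel (sym2Equiv (Site.shift v)) ⁻¹' S) =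
      ((bondPercolation (zdGraph 3) t).map F).real S := by
  rw [measureReal_def, measureReal_def, ← MeasurableEquiv.map_apply, map_relabel_shift_eq hFm hFeq t v]

/-- Union bound: `P(⋂_{i ∈ I} A_i) ≥ 1 - Σ_{i ∈ I} (1 - P(A_i))`. [folklore] -/
theorem one_sub_sum_le_real_biInter {Ω ι : Type*} [MeasurableSpace Ω] (P : Measure Ω)
    [IsProbabilityMeasure P] (I : Finset ι) {A : ι → Set Ω} (hA : ∀ i ∈ I, MeasurableSet (A i)) :
    1 - ∑ i ∈ I, (1 - P.real (A i)) ≤ P.real (⋂ i ∈ I, A i) := by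
  have h1 : P.real (⋂ i ∈ I, A i)ᶜ ≤ ∑ i ∈ I, P.real (A i)ᶜ := by
    rw [Set.compl_iInter₂]
    exact measureReal_biUnion_finset_le I _
  rw [measureReal_compl (I.measurableSet_biInter hA), probReal_univ] at h1
  have h2 : ∑ i ∈ I, P.real (A i)ᶜ = ∑ i ∈ I, (1 - P.real (A i)) :=
    Finset.sum_congr rfl fun i hi => by rw [measureReal_compl (hA i hi), probReal_univ]
  linarith

/-! ### Geometry of footprints -/

/-- The two ends of a lattice edge of `ℤ³` differ by at most `1` in every coordinate. [folklore] -/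
theorem abs_sub_le_one_of_mem_edge {e : Sym2 (Site 3)} (he : e ∈ (zdGraph 3).edgeSet)
    {y y' : Site 3} (hy : y ∈ e) (hy' : y' ∈ e) (i : Fin 3) : |y i - y' i| ≤ 1 := by
  induction e using Sym2.ind with
  | _ p q =>
    rw [SimpleGraph.mem_edgeSet] at he
    rw [Sym2.mem_iff] at hy hy'
    rcases hy with rfl | rfl <;> rcases hy' with rfl | rfl
    · simp
    · exact DCT16.abs_sub_le_one_of_adj he i
    · rw [abs_sub_comm]; exact DCT16.abs_sub_le_one_of_adj he i
    · simp

/-- The pairs of points of a box are finitely many. [folklore] -/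
theorem finite_pairs_near (c : Site 3) (r : ℤ) :
    {e : Sym2 (Site 3) | ∀ z ∈ e, ∀ i, |z i - c i| ≤ r}.Finite := by
  refine (Finset.finite_toSet (((box 3 r.toNat).image (· + c)).sym2)).subset ?_
  intro e he
  rw [Finset.mem_coe, Finset.mem_sym2_iff]
  intro z hz
  rw [Finset.mem_image]
  refine ⟨z - c, ?_, sub_add_cancel z c⟩
  rw [mem_box]
  intro i
  have h := abs_le.1 ((he z hz i).trans (Int.self_le_toNat r))
  simpa only [Pi.sub_apply] using h

/-- The lattice edges with an end within `r` of `c` are finitely many. [folklore] -/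
theorem finite_fp (c : Site 3) (r : ℤ) :
    {e' : Sym2 (Site 3) | e' ∈ (zdGraph 3).edgeSet ∧ ∃ y ∈ e', ∀ i, |y i - c i| ≤ r}.Finite := by
  refine (finite_pairs_near c (r + 1)).subset ?_
  rintro e' ⟨he, y, hy, hyc⟩ z hz i
  have h1 : |z i - y i| ≤ 1 := abs_sub_le_one_of_mem_edge he hz hy i
  calc |z i - c i| = |(z i - y i) + (y i - c i)| := by ring_nf
    _ ≤ |z i - y i| + |y i - c i| := abs_add_le _ _
    _ ≤ 1 + r := add_le_add h1 (hyc i)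
    _ = r + 1 := add_comm _ _

/-- **Locality of the label-side block event**: if `G` is determined by the pairs within `r` of
`c`, then `{ω | F (ω ∩ E) ∈ G}` is determined by the lattice edges with an end within `r + R` of
`c` (locality of `F` with range `R`; non-edges never matter after the restriction).
[cite: LiggettSchonmannStacey1997, §1 (block factors)] -/
theorem determinedBy_labelEvent {R : ℕ} {r : ℤ} {F : BondConfig (Site 3) → BondConfig (Site 3)}
    (hFloc : ∀ (ω ω' : BondConfig (Site 3)) (e : Sym2 (Site 3)),
      (∀ e' : Sym2 (Site 3), (∃ x ∈ e, ∃ y ∈ e', ∀ i, |x i - y i| ≤ (R : ℤ)) → (e' ∈ ω ↔ e' ∈ ω')) →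
        (e ∈ F ω ↔ e ∈ F ω'))
    {G : Set (BondConfig (Site 3))} {c : Site 3}
    (hG : DeterminedBy G {e : Sym2 (Site 3) | ∀ z ∈ e, ∀ i, |z i - c i| ≤ r}) :
    DeterminedBy {ω : BondConfig (Site 3) | F (ω ∩ (zdGraph 3).edgeSet) ∈ G}
      {e' : Sym2 (Site 3) | e' ∈ (zdGraph 3).edgeSet ∧ ∃ y ∈ e', ∀ i, |y i - c i| ≤ r + R} := by
  rw [determinedBy_iff] at hG ⊢
  intro ω ω' h
  simp only [Set.mem_setOf_eq]
  refine hG _ _ (Set.ext fun e => ?_)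
  simp only [Set.mem_inter_iff, Set.mem_setOf_eq]
  refine and_congr_left fun he => hFloc _ _ e fun e' ⟨x, hx, y, hy, hxy⟩ => ?_
  by_cases he' : e' ∈ (zdGraph 3).edgeSet
  · have hmem : e' ∈ {e' : Sym2 (Site 3) | e' ∈ (zdGraph 3).edgeSet ∧
        ∃ y ∈ e', ∀ i, |y i - c i| ≤ r + R} := by
      refine ⟨he', y, hy, fun i => ?_⟩
      calc |y i - c i| = |(y i - x i) + (x i - c i)| := by ring_nf
        _ ≤ |y i - x i| + |x i - c i| := abs_add_le _ _
        _ ≤ R + r := add_le_add (by rw [abs_sub_comm]; exact hxy i) (he x hx i)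
        _ = r + R := add_comm _ _
    have h1 : e' ∈ ω ∩ {e' : Sym2 (Site 3) | e' ∈ (zdGraph 3).edgeSet ∧
        ∃ y ∈ e', ∀ i, |y i - c i| ≤ r + R} ↔
        e' ∈ ω' ∩ {e' : Sym2 (Site 3) | e' ∈ (zdGraph 3).edgeSet ∧
          ∃ y ∈ e', ∀ i, |y i - c i| ≤ r + R} := by rw [h]
    simp only [Set.mem_inter_iff, hmem, and_true] at h1
    simp only [Set.mem_inter_iff, he', and_true, h1]
  · simp only [Set.mem_inter_iff, he', and_false]

end PercMonotoneFactorsLocalUniquenessCriterion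

end Summit.CriticalPhenomena.PercolationContinuityZ3.Theorems

end
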